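import Literature.MathematicalPhysics.QuantumFieldTheory.Balaban1983to89.B8SectETraceFreePer
import Literature.MathematicalPhysics.QuantumFieldTheory.Balaban1983to89.B8Prop5GaugeParamKLevelSrcPer

/-!
# [B8] Proposition 5's fixed point WITH A SOURCE (Theorem 8's (1.146)) ON THE TORUS — JOIN-B ∕ JOIN-C ∕ JOIN-C′ of the periodic × sourced existence
stack (B8-P5-NESTED-SERVER, existence instance (ii) «Theorem-8 source», layer E-ii-2)

Bałaban, *Comm. Math. Phys.* **99** (1985) 75–102 ([B8]; PDF page = printed page − 74): Prop. 5 (1.107)–(1.109) p. 94, Sect. D–E pp. 92–97,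
Thm 8 (1.146) p. 101, (1.29) p. 81, p. 77 («Ω_j ⊂ T_η»), §3 p. 98; [3] Prop. 10 p. 50; [4] Thm 3.1 p. 397, (3.24)–(3.25) p. 394.

WHY THIS FILE.  Instance (ii) of lead g33's WAKE-B8P5NestedServerExist (`LanF a U₀ φ m W := IsLandau146W … f W`, T6c's consumer) needs Proposition 5's
existence storeys at PERIODIC arguments WITH Theorem 8's source `f`.  The periodic chain of record (t2s-1's `B8Prop5JoinSectELocalRDTraceFreePer` ∕
`B8SectETraceFreePer`, J-SU trace functional) is source-free; the sourced chain (dag-n05-d's `B8Prop5JoinSectELocalRDSrc`) is on `ℤᵈ`.  THIS FILE merges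
them: the three periodic JOIN theorems with the trace functional DROPPED and the source delta ADDED — `{f mf} hmf hf hfsa` + `hfper` (`f` periodic, so that
the Neumann solution `Z_sol(W − f)` stays periodic), (1.103)∕(1.106) at `+ m_f∕2`, the multiplier clause «`Δ(𝟙_{Ω₀}(D*A + Δλ′ + 𝔑(λ′) − f)) = Q′ᵀμ`» via
n04-b's `dstar_rhs_eq_Z_sub_RZ` ∕ `multiplier_congr_on`; every other binder, constant and proof line VERBATIM from the per files.

WHAT THIS FILE PROVES (kernel, 0 sorry, theorems only): ★ `hFP_kLevel_of179_local_RD_src_per` (JOIN-B on `gaugeParam_kLevel_src_per`),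
★ `hFP_kLevel_of_sectE_local_RD_src_per` (JOIN-C, `H_c := −i·H′D′(u₁⁻¹, −i·)` by `exists_Dprime_map_per`), ★★ `hFP_kLevel_of_sectE_local'_RD_src_per`
(JOIN-C′, `hCequiv` by `Cnl_negStar_inv_of_axial`).

HONEST SCOPE.  Re-thread BY NAME over landed modules; nothing of [4], [3] Prop. 10, Sect. E or the contraction is proved here beyond composition; `hHequiv`
displayed; constants the lineage's.  Count-neutral; N05 NOT discharged; `T_η` read as `P`-periodic data on `ηℤᵈ`; one finite `T⁴` programme at fixed `ε`
— nothing continuum ∕ ℝ⁴ ∕ OS ∕ mass-gap ∕ Clay: the Yang–Mills mass gap is NOT proved here or by anything this file feeds.  No `sorry`, no `def`, no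
`instance`, no `notation`; §0's two private scalar lemmas are file-local copies of `B8SectETraceFreePer`'s.
-/

noncomputable section

open NormedSpace Metric Set Filter Topology
open Complex (I)
open scoped BigOperators

namespace Literature.MathematicalPhysics.QuantumFieldTheory.Balaban1983to89.B8Prop5JoinSectELocalRDSrcPer

open MatrixLog (mlog)
open B7Prop1Explicit (e U1 expUnit)
open B7Prop2Explicit (unitaryUnits C0 c2')
open B7Prop1Local (InBox pdevOn)
open B7Prop3Flat (expCfg c3)
open B7Eq78Linearization (conjR)
open B7Prop10General (C6 C4G)
open B7Prop9Flat (C5')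
open B8Ineq130 (tlo thi)
open B7Eq92Concrete (mgauge)
open B8Eq119TwistedAxial (InAx Restr129)
open B8Eq178Averages (Cond179)
open B8Ineq132 (covDerivFwd covDeriv)
open B8Eq138LandauZd (covLap covDivB QT)
open B8Eq182Proof (gAd)
open B8Eq184Proof (gaugeExp)
open B8Eq188Proof (frakF3 gAd_neg)
open B8LambdaSpaceKLevel (wt lamSubK lamOf norm_le_iff)
open B8Prop5ContractionKLevel (Bd2 Mc Kc Zsol Vop Wsrc PsiP5)
open B8Prop5GaugeParamKLevelPer (gpar_size_at)
open B8Eq195Linear (proj325_sub)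
open B8Prop5JoinSectELocal (restr129_mul_gaugeExp_local)
open B8Prop5JoinHFP (covLap_neg')
open B8Prop5NeumannPeriodic (zsol_per Wsrc_per Vop_per covDivB_per)
open B8Thm2TorusLettersPerConv (covLap_per)
open B7Prop2Explicit (unitaryUnits C0 c2' avgClosed_unitaryUnits)
open B7Eq78Linearization (conjR zdBlocking QprimeIter)
open B7Eq170Flat (cj)
open B7Prop10Flat (one_le_C5 C4'_nonneg C5'_nonneg)
open B7Eq214General (Cgen)
open B8Eq119TwistedAxial (bgT InAx Restr129)
open B8Eq178Averages (Qnl Cond179)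
open B8Eq1123Concrete (Cnl)
open B8Ineq125Concrete (C2p C2p_nonneg)
open B8Eq1117Concrete (XSpace)
open B8DprimeKLevelLipschitz (smallness_prod)
open B8SectERemainderCovariance (Cnl_negStar_inv_of_axial)
open B8Eq151V2Divergence (covDerivFwd_smul)
open B8Eq188Proof (frakF3)
open B8LambdaSpaceKLevel (wt lamSubK lamOf)
open B8Prop5ContractionKLevel (Bd2 Mc Kc)
open B8Prop5KLevelLetters (covLap_sub)
open B8Prop5JoinSectE (covLap_smul)
open B8Prop5JoinSectEPer (exists_Dprime_map_per)
open B8Prop5JoinSectELocal (cond179_of_eq114')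
open B8Prop5KLevelLetters (multiplier_congr_on dstar_rhs_eq_Z_sub_RZ)
open B8Prop5ContractionKLevelSrc (PsiP5src)
open B8Prop5GaugeParamKLevelSrcPer (gaugeParam_kLevel_src_per)

-- `Site` alone could resolve to the torus sites of `Setup.lean`; re-export the `ℤ^d` sites of `B7Prop1Explicit`.
export B7Prop1Explicit (Site)

variable {d : ℕ} {𝔸 : Type*} [CStarAlgebra 𝔸] [Nontrivial 𝔸]

/-! ## §0 Bookkeeping (file-local copies of `B8SectETraceFreePer`'s two private scalar lemmas) -/

section Bookkeeping

omit [Nontrivial 𝔸] in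
/-- `‖(−i)·a‖ = ‖a‖`. [folklore] -/
private theorem norm_negI_smul (a : 𝔸) : ‖(-I) • a‖ = ‖a‖ := by
  rw [norm_smul, norm_neg, Complex.norm_I, one_mul]

omit [Nontrivial 𝔸] in
/-- `(−i)·a` is Hermitian when `a* = −a`. [folklore] -/
private theorem isSelfAdjoint_negI_smul_of_skew {a : 𝔸} (ha : star a = -a) : IsSelfAdjoint ((-I) • a) := by
  have h1 : star ((-I) • a) = I • star a := by rw [star_smul, star_neg, Complex.star_def, Complex.conj_I, neg_neg]
  rw [IsSelfAdjoint, h1, ha, smul_neg, ← neg_smul]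

end Bookkeeping

/-! ## §1 JOIN-B with a source, on the torus -/

section Local

variable {L k : ℕ} {η : ℝ} {Ω Λs : ℕ → Set (Site d)} {Eb : ℕ → Set (Site d × Fin d)} {U₀ : Site d → Fin d → 𝔸ˣ}
  {A : Site d → Fin d → 𝔸} {u₁ : Site d → 𝔸ˣ}

/-- ★ **PROPOSITION 5's GAUGE PARAMETER WITH A SOURCE (JOIN-B, local route), ON THE TORUS** — t2s-1's
`B8Prop5JoinSectELocalRDTraceFreePer.hFP_kLevel_of179_local_RD_traceFree_per` with the trace functional dropped (JOIN-A =
`B8Prop5GaugeParamKLevelSrcPer.gaugeParam_kLevel_src_per`) and dag-n05-d's source delta of `B8Prop5JoinSectELocalRDSrc.hFP_kLevel_of179_local_RD_src`: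
a fixed PERIODIC Hermitian `f` with `Bd2`-size `m_f`, (1.103)∕(1.106) at `h₂ + m_f∕2`, the multiplier clause WITH SOURCE «`Δ_{U₀}(𝟙_{Ω₀}(D*A + Δλ′ + 𝔑(λ′) − f)) = Q′ᵀμ` on `Ω₀`»
(n04-b's `dstar_rhs_eq_Z_sub_RZ` ∕ `multiplier_congr_on`).  Everything else VERBATIM from the per file: (E1) `g_rightΩ`, (E2) `c_range` at periodic
arguments, periodic datum `U₀, A, u₁`, periodic-valued `G′, H_c`, periodicity-preserving `Q′ᵀCQ′`, the Theorem-4 tower-local regime (`hBu h69 hP hAx h129 hsmall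
hc₃ hsc`), (1.29) for `u₁·e^{iλ′}` by `restr129_mul_gaugeExp_local`; conclusion: `λ′` periodic, Hermitian, `= 0` off `Ω₀`, (1.108), multiplier form, (1.29).
[cite: Balaban1985RegularSpaces, Prop. 5 (1.107)–(1.109) p.94, (1.95)–(1.106) pp.92–94, (1.113)–(1.114) p.95, Thm 8 (1.146) p.101, (1.29) p.81, §3 p.98] -/
theorem hFP_kLevel_of179_local_RD_src_per (hL : 2 ≤ L) (hη : 0 < η) (hd : 1 ≤ d) (hU₀ : ∀ x κ, U₀ x κ ∈ unitaryUnits 𝔸) (P : ℤ)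
    (hEbΩ : ∀ j, j ≤ k → ∀ x ∈ Ω j, ∀ μ : Fin d, (x, μ) ∈ Eb j ∧ (x - e μ, μ) ∈ Eb j)
    (hEbT : ∀ j, j ≤ k → ∀ y ∈ Λs j, ∀ (x : Site d) (κ : Fin d), InBox (tlo L y j) (thi L y j) x →
      InBox (tlo L y j) (thi L y j) (x + e κ) → (x, κ) ∈ Eb j)
    -- letters of [4]
    (g Δ : (Site d → 𝔸) →ₗ[ℂ] (Site d → 𝔸)) (q : (Site d → 𝔸) →ₗ[ℂ] (ℕ → Site d → 𝔸)) (qs : (ℕ → Site d → 𝔸) →ₗ[ℂ] (Site d → 𝔸))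
    (Aw c : (ℕ → Site d → 𝔸) →ₗ[ℂ] (ℕ → Site d → 𝔸))
    (g_rightΩ : ∀ x, (∀ (z : Site d) (i : Fin d), x (z + P • e i) = x z) → ∀ y ∈ Ω 0, (Δ (g x) + qs (Aw (q (g x)))) y = x y)
    (c_range : ∀ f, (∀ (z : Site d) (i : Fin d), f (z + P • e i) = f z) → q (g (g (qs (c (q f))))) = q f)
    -- the torus: periodic background ∕ datum, periodicity-preserving letters
    (hU₀per : ∀ (z : Site d) (i : Fin d), U₀ (z + P • e i) = U₀ z) (hAper : ∀ (z : Site d) (i : Fin d), A (z + P • e i) = A z)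
    (hGper : ∀ (f : Site d → 𝔸) (z : Site d) (i : Fin d), g f (z + P • e i) = g f z)
    (hqcq_per : ∀ f : Site d → 𝔸, (∀ (z : Site d) (i : Fin d), f (z + P • e i) = f z) →
      ∀ (z : Site d) (i : Fin d), qs (c (q f)) (z + P • e i) = qs (c (q f)) z)
    (hΔ : ∀ (f : Site d → 𝔸), ∀ x ∈ Ω 0, Δ f x = covLap η U₀ ((Ω 0).indicator f) x)
    (hqs : ∀ (μ : ℕ → Site d → 𝔸), ∀ x ∈ Ω 0, qs μ x = QT L k Λs U₀ μ x)
    (Hc : (Site d → 𝔸) → (Site d → 𝔸))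
    -- the tower-local regime of the inversion route (datum AT u₁)
    {B : Site d → Fin d → 𝔸} {α₀ αP cB : ℝ}
    (hα : 0 < α₀) (hα3 : C0 d * α₀ ≤ 1 / 3) (hα4 : 4 * α₀ ≤ c2' d L) (hcB : 0 ≤ cB)
    (hαP : 0 < αP) (hαP3 : C0 d * αP ≤ 1 / 3) (hαP2 : 2 * αP ≤ c2' d L)
    (hBu : ∀ (x : Site d) (κ : Fin d), expCfg B x κ ∈ unitaryUnits 𝔸)
    (h33 : ∀ j, j ≤ k → ∀ y ∈ Λs j, pdevOn (tlo L y j) (thi L y j) U₀ < α₀ * (((L : ℝ) ^ j)⁻¹) ^ 2)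
    (h69 : ∀ j, j ≤ k → ∀ y ∈ Λs j, ∀ (x : Site d) (κ : Fin d), InBox (tlo L y j) (thi L y j) x →
      InBox (tlo L y j) (thi L y j) (x + e κ) → ‖B x κ‖ ≤ cB * ((L : ℝ) ^ j)⁻¹)
    (hP : ∀ j, j ≤ k → ∀ y ∈ Λs j, pdevOn (tlo L y j) (thi L y j) (expCfg B * U₀) < αP * (((L : ℝ) ^ j)⁻¹) ^ 2)
    (hAx : InAx L k Λs U₀ (mgauge U₀ u₁ (expCfg B) * U₀)) (h129 : Restr129 L k Λs U₀ u₁)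
    (hsmall : Real.exp (4 * (800 * ((d : ℝ) + 1) ^ 2 * ((d : ℝ) + 4)) * α₀) * (1 + 8 * (131072 * ((d : ℝ) + 1) ^ 2) * cB) ≤ 2)
    (hc₃ : 2 * cB ≤ c3 d L) (hsc : 2048 * (d : ℝ) * cB ≤ 1) (hα₃' : 40 * d * cB ≤ 1 / 200)
    {α₄ BG BR h₀ h₁ h₂ l₀ l₁ l₂ cA cDA : ℝ}
    (hw₁ : 10 * C6 d * (4 * (2 * α₄)) ≤ 1) (hw₂ : 3000 * ((d : ℝ) + 1) * L * (4 * (2 * α₄)) ≤ 1)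
    (hw₃ : C4G d L * (α₀ + 40 * d * cB + 4 * (2 * α₄)) ≤ 1)
    (hw₄ : 1024 * ((d : ℝ) + 1) * ((d : ℝ) + 4) * L ^ 2 * α₀ ≤ 1) (hw₅ : 32 * ((d : ℝ) + 1) ^ 2 * C6 d * L ^ 2 * α₀ ≤ 1)
    (hw₆ : 16 * d * C5' d * C6 d * (L : ℝ) ^ 2 * α₀ ≤ 1) (hprod : 2 * C6 d * (40 * d * cB + 4 * (2 * α₄)) < 1 / 2)
    -- JOIN-B's windows, letters G′/R, H_c's eight binders, the datum
    (hα₄ : 0 < α₄) (hBG : 0 ≤ BG) (hBR : 0 ≤ BR) (hh₀ : 0 ≤ h₀) (hh₂ : 0 ≤ h₂) (hl₀ : 0 ≤ l₀) (hl₁ : 0 ≤ l₁)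
    (hl₂ : 0 ≤ l₂) (hcA : 0 ≤ cA) (hcA' : cA ≤ 1 / 13) (hcDA : 0 ≤ cDA)
    (ha₁' : α₄ / 4 + h₀ ≤ 1 / 24) (hb₁' : α₄ / 4 + h₁ ≤ 1 / 140) (hb₁ : 0 < α₄ / 4 + h₁) (hθ : 10 * (α₄ / 4 + h₀) * BR ≤ 1 / 2)
    (hh₀' : h₀ ≤ 3 * α₄ / 4) (hh₁' : h₁ ≤ 3 * α₄ / 4)
    (hG : ∀ (f : Site d → 𝔸) (m : ℝ), 0 ≤ m → Bd2 L η k Ω f m →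
      (∀ x, ‖g f x‖ ≤ BG * m) ∧ ∀ j, j ≤ k → ∀ p ∈ Eb j, wt L η j * ‖covDerivFwd η U₀ p.2 (g f) p.1‖ ≤ BG * m)
    (hGsupp : ∀ (f : Site d → 𝔸) (x : Site d), x ∉ Ω 0 → g f x = 0)
    (hGreal : ∀ f : Site d → 𝔸, (∀ j, j ≤ k → ∀ x ∈ Ω j, IsSelfAdjoint (f x)) → ∀ x, IsSelfAdjoint (g f x))
    (hRbd : ∀ (f : Site d → 𝔸) (m : ℝ), 0 ≤ m → Bd2 L η k Ω f m → Bd2 L η k Ω (f - g (qs (c (q (g f))))) (BR * m))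
    (hRreal : ∀ f : Site d → 𝔸, (∀ j, j ≤ k → ∀ x ∈ Ω j, IsSelfAdjoint (f x)) →
      ∀ j, j ≤ k → ∀ x ∈ Ω j, IsSelfAdjoint ((f - g (qs (c (q (g f))))) x))
    (hc0 : ∀ s : lamSubK η U₀ L k Eb, (∀ (z : Site d) (i : Fin d), lamOf s (z + P • e i) = lamOf s z) → ‖s‖ ≤ α₄ / 4 →
      ∀ x, ‖Hc (lamOf s) x‖ ≤ h₀)
    (hc1 : ∀ s : lamSubK η U₀ L k Eb, (∀ (z : Site d) (i : Fin d), lamOf s (z + P • e i) = lamOf s z) → ‖s‖ ≤ α₄ / 4 →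
      ∀ j, j ≤ k → ∀ p ∈ Eb j, wt L η j * ‖covDerivFwd η U₀ p.2 (Hc (lamOf s)) p.1‖ ≤ h₁)
    (hc2 : ∀ s : lamSubK η U₀ L k Eb, (∀ (z : Site d) (i : Fin d), lamOf s (z + P • e i) = lamOf s z) → ‖s‖ ≤ α₄ / 4 →
      Bd2 L η k Ω (covLap η U₀ (Hc (lamOf s))) h₂)
    (hcL0 : ∀ s t : lamSubK η U₀ L k Eb, (∀ (z : Site d) (i : Fin d), lamOf s (z + P • e i) = lamOf s z) → (∀ (z : Site d) (i : Fin d), lamOf t (z + P • e i) = lamOf t z) →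
      ‖s‖ ≤ α₄ / 4 → ‖t‖ ≤ α₄ / 4 → ∀ x, ‖Hc (lamOf s) x - Hc (lamOf t) x‖ ≤ l₀ * ‖s - t‖)
    (hcL1 : ∀ s t : lamSubK η U₀ L k Eb, (∀ (z : Site d) (i : Fin d), lamOf s (z + P • e i) = lamOf s z) → (∀ (z : Site d) (i : Fin d), lamOf t (z + P • e i) = lamOf t z) →
      ‖s‖ ≤ α₄ / 4 → ‖t‖ ≤ α₄ / 4 → ∀ j, j ≤ k → ∀ p ∈ Eb j,
      wt L η j * ‖covDerivFwd η U₀ p.2 (Hc (lamOf s) - Hc (lamOf t)) p.1‖ ≤ l₁ * ‖s - t‖)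
    (hcL2 : ∀ s t : lamSubK η U₀ L k Eb, (∀ (z : Site d) (i : Fin d), lamOf s (z + P • e i) = lamOf s z) → (∀ (z : Site d) (i : Fin d), lamOf t (z + P • e i) = lamOf t z) →
      ‖s‖ ≤ α₄ / 4 → ‖t‖ ≤ α₄ / 4 → Bd2 L η k Ω (covLap η U₀ (Hc (lamOf s)) - covLap η U₀ (Hc (lamOf t))) (l₂ * ‖s - t‖))
    (hcsa : ∀ s : lamSubK η U₀ L k Eb, (∀ (z : Site d) (i : Fin d), lamOf s (z + P • e i) = lamOf s z) → ‖s‖ ≤ α₄ / 4 →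
      (∀ x, IsSelfAdjoint (lamOf s x)) → ∀ x, IsSelfAdjoint (Hc (lamOf s) x))
    (hcsupp : ∀ s : lamSubK η U₀ L k Eb, (∀ (z : Site d) (i : Fin d), lamOf s (z + P • e i) = lamOf s z) → ‖s‖ ≤ α₄ / 4 →
      ∀ x, x ∉ Ω 0 → Hc (lamOf s) x = 0)
    (hcper : ∀ s : lamSubK η U₀ L k Eb, (∀ (z : Site d) (i : Fin d), lamOf s (z + P • e i) = lamOf s z) → ‖s‖ ≤ α₄ / 4 →
      ∀ (z : Site d) (i : Fin d), Hc (lamOf s) (z + P • e i) = Hc (lamOf s) z)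
    (hDA : Bd2 L η k Ω (fun y => covDivB η U₀ A y) cDA) (hDAsa : ∀ j, j ≤ k → ∀ x ∈ Ω j, IsSelfAdjoint (covDivB η U₀ A x))
    (hA : ∀ j, j ≤ k → ∀ x ∈ Ω j, ∀ μ : Fin d,
      wt L η j * ‖A x μ‖ ≤ cA ∧ wt L η j * ‖conjR (U₀ (x - e μ) μ)⁻¹ (A (x - e μ) μ)‖ ≤ cA)
    (hAsa : ∀ x μ, IsSelfAdjoint (A x μ))
    -- THE SOURCE of Theorem 8's (1.146): a fixed PERIODIC function with finite `|f|₍₋₂₎` on the `Ω_j`, Hermitian there («f from the space R(U₀)»)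
    {f : Site d → 𝔸} {mf : ℝ} (hmf : 0 ≤ mf) (hf : Bd2 L η k Ω f mf) (hfsa : ∀ j, j ≤ k → ∀ x ∈ Ω j, IsSelfAdjoint (f x))
    (hfper : ∀ (z : Site d) (i : Fin d), f (z + P • e i) = f z)
    (h103 : BG * Mc d BR (α₄ / 4 + h₁) cA (h₂ + mf / 2) cDA ≤ α₄ / 4)
    (h106 : BG * Kc d BR (α₄ / 4 + h₁) cA (h₂ + mf / 2) cDA l₂ (1 + l₀) (1 + l₁) ≤ 1 / 2)
    -- Sect. E's (1.114) in its printed use, for the inverse pair, at the abstract H_c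
    (h179E : ∀ s : lamSubK η U₀ L k Eb, (∀ (z : Site d) (i : Fin d), lamOf s (z + P • e i) = lamOf s z) → ‖s‖ ≤ α₄ / 4 → q (lamOf s) = 0 →
      Cond179 L k Λs U₀ (fun x => expUnit (((-I) • (lamOf s + Hc (lamOf s))) x)) u₁⁻¹) :
    ∃ lam : Site d → 𝔸, (∀ (z : Site d) (i : Fin d), lam (z + P • e i) = lam z) ∧
      (∀ x, IsSelfAdjoint (lam x)) ∧ (∀ x, x ∉ Ω 0 → lam x = 0) ∧
      (∀ j, j ≤ k → ∀ p ∈ Eb j, ‖lam p.1‖ ≤ α₄ ∧ wt L η j * ‖covDerivFwd η U₀ p.2 lam p.1‖ ≤ α₄) ∧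
      (∃ μ : ℕ → Site d → 𝔸, ∀ x ∈ Ω 0,
        covLap η U₀ ((Ω 0).indicator fun y => covDivB η U₀ A y + covLap η U₀ lam y +
          ((conjR (gaugeExp lam y)⁻¹ (covDivB η U₀ A y) - covDivB η U₀ A y) +
            (gAd (covLap η U₀ lam y) (lam y) - covLap η U₀ lam y) + ∑ μ, frakF3 η U₀ lam A y μ) - f y) x = QT L k Λs U₀ μ x) ∧
      Restr129 L k Λs U₀ (u₁ * gaugeExp lam) := by
  have hL1 : 1 ≤ L := le_trans (by norm_num) hL
  -- the letter R of (1.95)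
  set R : (Site d → 𝔸) → (Site d → 𝔸) := fun f => f - g (qs (c (q (g f)))) with hRdef
  have hR : ∀ f, R f = f - g (qs (c (q (g f)))) := fun f => rfl
  have hRsub : ∀ f f' : Site d → 𝔸, R (f - f') = R f - R f' := proj325_sub (R := R) hR
  have hR0 : R 0 = 0 := by rw [hR]; simp
  have hRneg : ∀ f : Site d → 𝔸, R (-f) = -R f := fun f => by rw [← zero_sub, hRsub, hR0, zero_sub]
  have hRper : ∀ f : Site d → 𝔸, (∀ (z : Site d) (i : Fin d), f (z + P • e i) = f z) →
      ∀ (z : Site d) (i : Fin d), R f (z + P • e i) = R f z := fun f hf z i => by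
    simp only [hR, Pi.sub_apply, hf z i, hGper]
  -- JOIN-A
  obtain ⟨s, s', hp, hp', hs, hfix, hs', hn', hsa', hoff', hN⟩ := gaugeParam_kLevel_src_per (Ω := Ω) (Eb := Eb) (U₀ := U₀) (A := A) (f := f)
    (DA := fun y => covDivB η U₀ A y) hL1 hη hU₀ P hEbΩ (⇑g) R Hc hα₄.le hBG hBR hh₀ hh₂ hl₀ hl₁ hl₂ hcA hcA' hcDA ha₁' hb₁' hb₁ hθ
    hh₀' hh₁' hG (fun f f' => map_sub g f f') hGper hGsupp hGreal hRsub hRbd hRreal hc0 hc1 hc2 hcL0 hcL1 hcL2 hcsa hcsupp hcper hDA hDAsa hA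
    hAsa hmf hf hfsa h103 h106
  set lam' := lamOf s' with hlam'def
  have hgp : lamOf s + Hc (lamOf s) = lam' := hs'.symm
  -- the Neumann solution at λ′
  set Z : Site d → 𝔸 := Zsol (Wsrc η U₀ A (fun y => covDivB η U₀ A y) lam' (covLap η U₀ (Hc (lamOf s))) - f) (Vop lam') R with hZdef
  -- on the torus: Z, −Z, R(−Z), g Z are periodic
  have hWf : ∀ (z : Site d) (i : Fin d), (Wsrc η U₀ A (fun y => covDivB η U₀ A y) lam' (covLap η U₀ (Hc (lamOf s))) - f) (z + P • e i) =
      (Wsrc η U₀ A (fun y => covDivB η U₀ A y) lam' (covLap η U₀ (Hc (lamOf s))) - f) z := fun z i => by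
    rw [Pi.sub_apply, Pi.sub_apply, Wsrc_per hU₀per hAper (covDivB_per hU₀per hAper) hp' (covLap_per hU₀per (hcper s hp hs)) z i, hfper z i]
  have hZper : ∀ (z : Site d) (i : Fin d), Z (z + P • e i) = Z z :=
    zsol_per hWf (fun g' hg' => Vop_per hp' hg') hRper
  have hZneg : ∀ (z : Site d) (i : Fin d), (-Z) (z + P • e i) = (-Z) z := fun z i => by simp only [Pi.neg_apply, hZper z i]
  -- the fixed point read through the projection laws: Q′λ = 0 and Δλ = R(−Z)
  have hfix' : lamOf s = g (R (fun x => -Z x)) := by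
    have h := hfix
    simp only [PsiP5src] at h
    rw [hgp] at h
    exact h
  have hfix'' : lamOf s = g (R (-Z)) := hfix'
  have hqR : q (g (R (-Z))) = 0 := by
    rw [hR, map_sub, map_sub, c_range _ (fun z i => hGper _ z i), sub_self]
  have hq : q (lamOf s) = 0 := by rw [hfix'']; exact hqR
  -- «ΔG′R = R» read POINTWISE on Ω₀ (the right-inverse law of G′ on print's domain)
  have hΔs : ∀ y ∈ Ω 0, Δ (lamOf s) y = R (-Z) y := fun y hy => by
    have h1 := g_rightΩ (R (-Z)) (hRper _ hZneg) y hy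
    rw [hqR, map_zero, map_zero, add_zero] at h1
    rw [hfix'']
    exact h1
  -- sizes at λ′ on Ω₀
  have hl : ∀ y ∈ Ω 0, ‖lam' y‖ ≤ 1 / 12 := fun y _ => by
    rw [← hgp]; exact (gpar_size_at s hs (hc0 s hp hs) y).trans (ha₁'.trans (by norm_num))
  -- support of λ_s (Dirichlet range of G′)
  have hoff : ∀ x, x ∉ Ω 0 → lamOf s x = 0 := fun x hx => by rw [hfix'']; exact hGsupp _ x hx
  have hind : (Ω 0).indicator (lamOf s) = lamOf s := by
    funext x
    by_cases hx : x ∈ Ω 0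
    · rw [Set.indicator_of_mem hx]
    · rw [Set.indicator_of_notMem hx, hoff x hx]
  refine ⟨lam', hp', hsa', hoff', fun j hj p hpj => ?_, ?_, ?_⟩
  · -- (1.108)
    have h := (norm_le_iff hη.le s' hα₄.le).1 hn'
    exact ⟨h.1 p.1, h.2 j hj p hpj⟩
  · -- the multiplier clause WITH SOURCE: n04-b's WHY-Z identity at `Z′ + f` gives `D*A + Δλ′ + 𝔑(λ′) − f = Z′ − RZ′` on `Ω₀`
    have hdef : lam' = lamOf s - (-Hc (lamOf s)) := by rw [sub_neg_eq_add, hgp]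
    have hNy : ∀ y ∈ Ω 0, (Z + f) y + (gAd (R Z y) (lam' y) - R Z y) =
        conjR (gaugeExp lam' y)⁻¹ (covDivB η U₀ A y) - gAd (covLap η U₀ (-Hc (lamOf s)) y) (lam' y) + ∑ μ, frakF3 η U₀ lam' A y μ := by
      intro y hy
      have h := hN 0 (Nat.zero_le _) y hy
      simp only [Vop, Wsrc] at h
      rw [Pi.add_apply, covLap_neg', gAd_neg _ (hl y hy), sub_neg_eq_add]
      calc Z y + f y + (gAd (R Z y) (lam' y) - R Z y) = (Z y + (gAd (R Z y) (lam' y) - R Z y)) + f y := by abel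
        _ = _ := by rw [h]; abel
    have hΔy : ∀ y ∈ Ω 0, covLap η U₀ (lamOf s) y = -R Z y := by
      intro y hy
      rw [← hind, ← hΔ _ y hy, hΔs y hy, hRneg, Pi.neg_apply]
    have hpt : ∀ y ∈ Ω 0, covDivB η U₀ A y + covLap η U₀ lam' y +
        ((conjR (gaugeExp lam' y)⁻¹ (covDivB η U₀ A y) - covDivB η U₀ A y) +
          (gAd (covLap η U₀ lam' y) (lam' y) - covLap η U₀ lam' y) + ∑ μ, frakF3 η U₀ lam' A y μ) - f y = (Z - R Z) y := by
      intro y hy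
      rw [dstar_rhs_eq_Z_sub_RZ U₀ A hdef (hl y hy) (hNy y hy) (hΔy y hy), Pi.add_apply, Pi.sub_apply]
      abel
    refine (multiplier_congr_on L k (Ω 0) Λs U₀ hpt).2 ?_
    set φ := c (q (g Z)) with hφ
    refine ⟨φ - Aw (q (g (qs φ))), fun x hx => ?_⟩
    have hZR : Z - R Z = g (qs φ) := by rw [hR]; abel
    -- «ΔG′Q′ᵀφ = Q′ᵀ(φ − 𝔄Q′G′Q′ᵀφ)» read POINTWISE on Ω₀
    have hlap : Δ (g (qs φ)) x = qs (φ - Aw (q (g (qs φ)))) x := by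
      rw [map_sub, Pi.sub_apply]
      exact eq_sub_of_add_eq (by rw [← Pi.add_apply]; exact g_rightΩ (qs φ) (hqcq_per _ fun z i => hGper _ z i) x hx)
    rw [← hΔ _ x hx, hZR, hlap, hqs _ x hx]
  · -- (1.29) for u₁·e^{iλ′} by the LOCAL inversion route
    rw [← hgp]
    -- the local route at THIS `s` (its `H_c`-inputs are read at `s` only: feed the constant map `λ ↦ H_cλ_s`)
    exact restr129_mul_gaugeExp_local hL hη hd hU₀ hEbT hα hα3 hα4 hcB hα₄ hαP hαP3 hαP2 hBu h33 h69 hP hAx h129 hsmall hc₃ hsc hα₃' hw₁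
      hw₂ hw₃ hw₄ hw₅ hw₆ hprod (fun _ => Hc (lamOf s)) hh₀' hh₁' (fun _ _ x => hc0 s hp hs x) (fun _ _ j hj p hpj => hc1 s hp hs j hj p hpj) s hs
      (h179E s hp hs hq)

end Local

/-! ## §2 JOIN-C ∕ JOIN-C′ with a source, on the torus -/

section JoinLocal

variable {L k : ℕ} {η : ℝ} {Ω Λs : ℕ → Set (Site d)} {Eb : ℕ → Set (Site d × Fin d)} {U₀ : Site d → Fin d → 𝔸ˣ}
  {A : Site d → Fin d → 𝔸} {u₁ : Site d → 𝔸ˣ}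

/-- ★ **PROPOSITION 5's FIXED POINT WITH A SOURCE (JOIN-C, local inversion route), ON THE TORUS** — t2s-1's
`B8SectETraceFreePer.hFP_kLevel_of_sectE_local_RD_traceFree_per` with the trace functional dropped and dag-n05-d's source delta
(`B8Prop5JoinSectELocalRDSrc.hFP_kLevel_of_sectE_local_RD_src`): `H_c := −i·H′D′(u₁⁻¹, −i·)` by `B8Prop5JoinSectEPer.exists_Dprime_map_per` (unchanged — the
source does not enter Sect. E), the (1.29)-clause and the multiplier form WITH SOURCE by `hFP_kLevel_of179_local_RD_src_per`.  (E1), (E2), (1.91) at periodic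
arguments only; `f` periodic; [3]'s remainder covariance `hCequiv` displayed (discharged in the primed twin).
[cite: Balaban1985RegularSpaces, Prop. 5 (1.107)–(1.109) p.94, (1.92) p.91, (1.95)–(1.106) pp.92–94, (1.113)–(1.121) pp.95–97, Thm 8 (1.146) p.101, (1.29) p.81, §3 p.98; Balaban1985Averaging, Prop. 10 (203)–(204) p.50, (213)–(214) p.50] -/
theorem hFP_kLevel_of_sectE_local_RD_src_per (hL : 2 ≤ L) (hη : 0 < η) (hU₀ : ∀ x κ, U₀ x κ ∈ unitaryUnits 𝔸) (P : ℤ)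
    (hEbΩ : ∀ j, j ≤ k → ∀ x ∈ Ω j, ∀ μ : Fin d, (x, μ) ∈ Eb j ∧ (x - e μ, μ) ∈ Eb j)
    (hEbT : ∀ j, j ≤ k → ∀ y ∈ Λs j, ∀ (x : Site d) (κ : Fin d), InBox (tlo L y j) (thi L y j) x →
      InBox (tlo L y j) (thi L y j) (x + e κ) → (x, κ) ∈ Eb j)
    -- letters of [4]
    (g Δ : (Site d → 𝔸) →ₗ[ℂ] (Site d → 𝔸)) (q : (Site d → 𝔸) →ₗ[ℂ] (ℕ → Site d → 𝔸)) (qs : (ℕ → Site d → 𝔸) →ₗ[ℂ] (Site d → 𝔸))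
    (Aw c : (ℕ → Site d → 𝔸) →ₗ[ℂ] (ℕ → Site d → 𝔸))
    (g_rightΩ : ∀ x, (∀ (z : Site d) (i : Fin d), x (z + P • e i) = x z) → ∀ y ∈ Ω 0, (Δ (g x) + qs (Aw (q (g x)))) y = x y)
    (c_range : ∀ f, (∀ (z : Site d) (i : Fin d), f (z + P • e i) = f z) → q (g (g (qs (c (q f))))) = q f)
    -- the torus: period `P` (every `Lʲ ∣ P`), shift-invariant `Λ_j`, periodic `U₀`, `A`, `u₁`; periodicity-preserving `G′`, `Q′ᵀCQ′`, `H′`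
    (hdiv : ∀ j, j ≤ k → ((L : ℤ) ^ j ∣ P))
    (hΛ : ∀ j, j ≤ k → ∀ (y : Site d) (i : Fin d), y + (P / (L : ℤ) ^ j) • e i ∈ Λs j ↔ y ∈ Λs j)
    (hU₀per : ∀ (z : Site d) (i : Fin d), U₀ (z + P • e i) = U₀ z) (hAper : ∀ (z : Site d) (i : Fin d), A (z + P • e i) = A z)
    (hu₁per : ∀ (z : Site d) (i : Fin d), u₁ (z + P • e i) = u₁ z)
    (hGper : ∀ (f : Site d → 𝔸) (z : Site d) (i : Fin d), g f (z + P • e i) = g f z)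
    (hqcq_per : ∀ f : Site d → 𝔸, (∀ (z : Site d) (i : Fin d), f (z + P • e i) = f z) →
      ∀ (z : Site d) (i : Fin d), qs (c (q f)) (z + P • e i) = qs (c (q f)) z)
    (hΔ : ∀ (f : Site d → 𝔸), ∀ x ∈ Ω 0, Δ f x = covLap η U₀ ((Ω 0).indicator f) x)
    (hqs : ∀ (μ : ℕ → Site d → 𝔸), ∀ x ∈ Ω 0, qs μ x = QT L k Λs U₀ μ x)
    (hq : ∀ (f : Site d → 𝔸) (j : ℕ), j ≤ k → ∀ y ∈ Λs j, q f j y = QprimeIter (zdBlocking d L) (bgT L U₀) j f y)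
    -- the letter H′ of [4] ((1.92)) and the Sect. E / local-inversion regime (tower-local, everything AT u₁)
    (H' : XSpace d k 𝔸 →ₗ[ℂ] (Site d → 𝔸)) {B : Site d → Fin d → 𝔸} {α₀ αP α₄ cB B₀' B₂' : ℝ}
    (hα : 0 < α₀) (hα3 : C0 d * α₀ ≤ 1 / 3) (hα4 : 4 * α₀ ≤ c2' d L) (hcB : 0 ≤ cB) (hα₄ : 0 < α₄) (hB : 0 < B₀') (hB₂ : 0 ≤ B₂')
    (h33 : ∀ j, j ≤ k → ∀ y ∈ Λs j, pdevOn (tlo L y j) (thi L y j) U₀ < α₀ * (((L : ℝ) ^ j)⁻¹) ^ 2)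
    (h69 : ∀ j, j ≤ k → ∀ y ∈ Λs j, ∀ (x : Site d) (κ : Fin d), InBox (tlo L y j) (thi L y j) x →
      InBox (tlo L y j) (thi L y j) (x + e κ) → ‖B x κ‖ ≤ cB * ((L : ℝ) ^ j)⁻¹)
    (hd : 1 ≤ d) (hαP : 0 < αP) (hαP3 : C0 d * αP ≤ 1 / 3) (hαP2 : 2 * αP ≤ c2' d L)
    (hBu : ∀ (x : Site d) (κ : Fin d), expCfg B x κ ∈ unitaryUnits 𝔸)
    (hP : ∀ j, j ≤ k → ∀ y ∈ Λs j, pdevOn (tlo L y j) (thi L y j) (expCfg B * U₀) < αP * (((L : ℝ) ^ j)⁻¹) ^ 2)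
    (hAx : InAx L k Λs U₀ (mgauge U₀ u₁ (expCfg B) * U₀)) (h129 : Restr129 L k Λs U₀ u₁)
    (hH0 : ∀ (X : XSpace d k 𝔸) (x : Site d), ‖H' X x‖ ≤ B₀' * ‖X‖)
    (hH1 : ∀ j, j ≤ k → ∀ (X : XSpace d k 𝔸), ∀ p ∈ Eb j, wt L η j * ‖covDerivFwd η U₀ p.2 (H' X) p.1‖ ≤ B₀' * ‖X‖)
    (hH2 : ∀ X : XSpace d k 𝔸, Bd2 L η k Ω (covLap η U₀ (H' X)) (B₂' * ‖X‖))
    (hHsupp : ∀ (X : XSpace d k 𝔸) (x : Site d), x ∉ Ω 0 → H' X x = 0)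
    (hHequiv : ∀ X Y : XSpace d k 𝔸, (∀ p, Y p = -star (X p)) → ∀ x, H' Y x = -star (H' X x))
    (hHper : ∀ X : XSpace d k 𝔸, (∀ (p : Fin (k + 1) × Site d) (i : Fin d), X (p.1, p.2 + (P / (L : ℤ) ^ (p.1 : ℕ)) • e i) = X p) →
      ∀ (z : Site d) (i : Fin d), H' X (z + P • e i) = H' X z)
    (hQH : ∀ (Y : XSpace d k 𝔸), (∀ (p : Fin (k + 1) × Site d) (i : Fin d), Y (p.1, p.2 + (P / (L : ℤ) ^ (p.1 : ℕ)) • e i) = Y p) →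
      ∀ (j : ℕ) (hj : j ≤ k) (y : Site d), y ∈ Λs j →
      QprimeIter (zdBlocking d L) (bgT L U₀) j (H' Y) y = Y (⟨j, Nat.lt_succ_of_le hj⟩, y))
    (hCequiv : ∀ j, j ≤ k → ∀ y ∈ Λs j, ∀ μ : Site d → 𝔸,
      (∀ x : Site d, InBox (tlo L y j) (thi L y j) x → ‖μ x‖ < α₄) →
      (∀ (x : Site d) (κ : Fin d), InBox (tlo L y j) (thi L y j) x → InBox (tlo L y j) (thi L y j) (x + e κ) →
        ‖cj (U₀ x κ) (μ (x + e κ)) - μ x‖ < α₄ * ((L : ℝ) ^ j)⁻¹) →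
      Cnl L U₀ u₁⁻¹ j (fun x => -star (μ x)) y = -star (Cnl L U₀ u₁⁻¹ j μ y))
    (hsmall : Real.exp (4 * (800 * ((d : ℝ) + 1) ^ 2 * ((d : ℝ) + 4)) * α₀) * (1 + 8 * (131072 * ((d : ℝ) + 1) ^ 2) * cB) ≤ 2)
    (hc₃ : 2 * cB ≤ c3 d L) (hsc : 2048 * (d : ℝ) * cB ≤ 1) (hα₃' : 40 * d * cB ≤ 1 / 200)
    (hs₁ : 200 * C6 d * (2 * α₄) ≤ 1) (hs₂ : 12000 * ((d : ℝ) + 1) * L * (2 * α₄) ≤ 1)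
    (hs₃ : C4G d L * (α₀ + 40 * d * cB + 4 * (2 * α₄)) ≤ 1)
    (hs₄ : 1024 * ((d : ℝ) + 1) * ((d : ℝ) + 4) * L ^ 2 * α₀ ≤ 1) (hs₅ : 32 * ((d : ℝ) + 1) ^ 2 * C6 d * L ^ 2 * α₀ ≤ 1)
    (hs₆ : 16 * d * C5' d * C6 d * (L : ℝ) ^ 2 * α₀ ≤ 1) (hs₇ : 8 * d * C6 d * L * α₀ ≤ 1)
    (hsm : 40 * d * cB + α₄ ≤ 1 / (4 * B₀' * (2 * C2p d))) (hprod : 2 * C6 d * (40 * d * cB + 4 * (2 * α₄)) < 1 / 2)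
    -- the Sect. E sizes of H_c (named, so that the windows below read)
    {hE hE₂ lE lE₂ : ℝ} (hE_def : hE = B₀' * (C2p d * (40 * d * cB + α₄) * α₄)) (hE₂_def : hE₂ = B₂' * (C2p d * (40 * d * cB + α₄) * α₄))
    (lE_def : lE = B₀' * (4 * C2p d * (40 * d * cB + 2 * α₄))) (lE₂_def : lE₂ = B₂' * (4 * C2p d * (40 * d * cB + 2 * α₄)))
    -- JOIN-B's letters G′, R, the datum, and its windows at these sizes
    {BG BR cA cDA : ℝ} (hBG : 0 ≤ BG) (hBR : 0 ≤ BR) (hcA : 0 ≤ cA) (hcA' : cA ≤ 1 / 13) (hcDA : 0 ≤ cDA)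
    (ha₁' : α₄ / 4 + hE ≤ 1 / 24) (hb₁' : α₄ / 4 + hE ≤ 1 / 140) (hθ : 10 * (α₄ / 4 + hE) * BR ≤ 1 / 2)
    (hG : ∀ (f : Site d → 𝔸) (m : ℝ), 0 ≤ m → Bd2 L η k Ω f m →
      (∀ x, ‖g f x‖ ≤ BG * m) ∧ ∀ j, j ≤ k → ∀ p ∈ Eb j, wt L η j * ‖covDerivFwd η U₀ p.2 (g f) p.1‖ ≤ BG * m)
    (hGsupp : ∀ (f : Site d → 𝔸) (x : Site d), x ∉ Ω 0 → g f x = 0)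
    (hGreal : ∀ f : Site d → 𝔸, (∀ j, j ≤ k → ∀ x ∈ Ω j, IsSelfAdjoint (f x)) → ∀ x, IsSelfAdjoint (g f x))
    (hRbd : ∀ (f : Site d → 𝔸) (m : ℝ), 0 ≤ m → Bd2 L η k Ω f m → Bd2 L η k Ω (f - g (qs (c (q (g f))))) (BR * m))
    (hRreal : ∀ f : Site d → 𝔸, (∀ j, j ≤ k → ∀ x ∈ Ω j, IsSelfAdjoint (f x)) →
      ∀ j, j ≤ k → ∀ x ∈ Ω j, IsSelfAdjoint ((f - g (qs (c (q (g f))))) x))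
    (hDA : Bd2 L η k Ω (fun y => covDivB η U₀ A y) cDA) (hDAsa : ∀ j, j ≤ k → ∀ x ∈ Ω j, IsSelfAdjoint (covDivB η U₀ A x))
    (hA : ∀ j, j ≤ k → ∀ x ∈ Ω j, ∀ μ : Fin d,
      wt L η j * ‖A x μ‖ ≤ cA ∧ wt L η j * ‖conjR (U₀ (x - e μ) μ)⁻¹ (A (x - e μ) μ)‖ ≤ cA)
    (hAsa : ∀ x μ, IsSelfAdjoint (A x μ))
    -- THE SOURCE of Theorem 8's (1.146): a fixed PERIODIC function with finite `|f|₍₋₂₎` on the `Ω_j`, Hermitian there («f from the space R(U₀)»)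
    {f : Site d → 𝔸} {mf : ℝ} (hmf : 0 ≤ mf) (hf : Bd2 L η k Ω f mf) (hfsa : ∀ j, j ≤ k → ∀ x ∈ Ω j, IsSelfAdjoint (f x))
    (hfper : ∀ (z : Site d) (i : Fin d), f (z + P • e i) = f z)
    (h103 : BG * Mc d BR (α₄ / 4 + hE) cA (hE₂ + mf / 2) cDA ≤ α₄ / 4)
    (h106 : BG * Kc d BR (α₄ / 4 + hE) cA (hE₂ + mf / 2) cDA lE₂ (1 + lE) (1 + lE) ≤ 1 / 2) :
    ∃ lam : Site d → 𝔸, (∀ (z : Site d) (i : Fin d), lam (z + P • e i) = lam z) ∧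
      (∀ x, IsSelfAdjoint (lam x)) ∧ (∀ x, x ∉ Ω 0 → lam x = 0) ∧
      (∀ j, j ≤ k → ∀ p ∈ Eb j, ‖lam p.1‖ ≤ α₄ ∧ wt L η j * ‖covDerivFwd η U₀ p.2 lam p.1‖ ≤ α₄) ∧
      (∃ μ : ℕ → Site d → 𝔸, ∀ x ∈ Ω 0,
        covLap η U₀ ((Ω 0).indicator fun y => covDivB η U₀ A y + covLap η U₀ lam y +
          ((conjR (gaugeExp lam y)⁻¹ (covDivB η U₀ A y) - covDivB η U₀ A y) +
            (gAd (covLap η U₀ lam y) (lam y) - covLap η U₀ lam y) + ∑ μ, frakF3 η U₀ lam A y μ) - f y) x = QT L k Λs U₀ μ x) ∧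
      Restr129 L k Λs U₀ (u₁ * gaugeExp lam) := by
  have hL1 : 1 ≤ L := le_trans (by norm_num) hL
  have hC2 : 0 ≤ C2p d := C2p_nonneg d
  have hC2pos : 0 < C2p d := by
    have hC6 : (2 : ℝ) ≤ C6 d := by unfold C6; linarith [one_le_C5 (d := d)]
    unfold C2p Cgen; positivity
  have hα₃ : (0 : ℝ) ≤ 40 * d * cB := by positivity
  have hhE : 0 ≤ hE := by rw [hE_def]; positivity
  have hhE₂ : 0 ≤ hE₂ := by rw [hE₂_def]; positivity
  have hlE : 0 ≤ lE := by rw [lE_def]; positivity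
  have hlE₂ : 0 ≤ lE₂ := by rw [lE₂_def]; positivity
  have hb₁ : 0 < α₄ / 4 + hE := add_pos_of_pos_of_nonneg (by positivity) hhE
  -- `h₀ ≤ ¾α₄` from print's smallness in product form
  have hh₀' : hE ≤ 3 * α₄ / 4 := by
    have h8 := (smallness_prod (d := d) (by positivity) hB hC2pos hsm).1
    have e1 : hE = (C2p d * (40 * d * cB + α₄) * B₀') * α₄ := by rw [hE_def]; ring
    rw [e1]
    calc C2p d * (40 * d * cB + α₄) * B₀' * α₄ ≤ 1 / 8 * α₄ := mul_le_mul_of_nonneg_right h8 hα₄.le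
      _ ≤ 3 * α₄ / 4 := by linarith only [hα₄]
  -- THE solution map D′(u₁⁻¹, −i·) on the ¼α₄-ball (chosen once; Lipschitz; real on Hermitian λ)
  obtain ⟨Dp, hDp, hDpL, hDpR⟩ := exists_Dprime_map_per hL hη hU₀ H' hα hα3 hα4 hcB hα₄ hB h33 h69 hd hαP hαP3 hαP2 hBu hP hAx h129 hEbT hH0 hH1
    hHequiv P hdiv hΛ hU₀per hu₁per hHper hQH hCequiv hsmall hc₃ hsc hα₃' hs₁ hs₂ hs₃ hs₄ hs₅ hs₆ hs₇ hsm
  -- sizes of D′ and of its differences, multiplied by the (1.92) constants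
  have hbdX : ∀ s : lamSubK η U₀ L k Eb, (∀ (z : Site d) (i : Fin d), lamOf s (z + P • e i) = lamOf s z) → ‖s‖ ≤ α₄ / 4 → B₀' * ‖Dp (lamOf s)‖ ≤ hE := fun s hp hs => by
    rw [hE_def]; exact mul_le_mul_of_nonneg_left (hDp s hp hs).2.2.1 hB.le
  have hbdX₂ : ∀ s : lamSubK η U₀ L k Eb, (∀ (z : Site d) (i : Fin d), lamOf s (z + P • e i) = lamOf s z) → ‖s‖ ≤ α₄ / 4 → B₂' * ‖Dp (lamOf s)‖ ≤ hE₂ := fun s hp hs => by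
    rw [hE₂_def]; exact mul_le_mul_of_nonneg_left (hDp s hp hs).2.2.1 hB₂
  have hbdL : ∀ s t : lamSubK η U₀ L k Eb, (∀ (z : Site d) (i : Fin d), lamOf s (z + P • e i) = lamOf s z) → (∀ (z : Site d) (i : Fin d), lamOf t (z + P • e i) = lamOf t z) →
      ‖s‖ ≤ α₄ / 4 → ‖t‖ ≤ α₄ / 4 → B₀' * ‖Dp (lamOf s) - Dp (lamOf t)‖ ≤ lE * ‖s - t‖ :=
    fun s t hps hpt hs ht => by
    rw [lE_def, mul_assoc]; exact mul_le_mul_of_nonneg_left (hDpL s t hps hpt hs ht) hB.le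
  have hbdL₂ : ∀ s t : lamSubK η U₀ L k Eb, (∀ (z : Site d) (i : Fin d), lamOf s (z + P • e i) = lamOf s z) → (∀ (z : Site d) (i : Fin d), lamOf t (z + P • e i) = lamOf t z) →
      ‖s‖ ≤ α₄ / 4 → ‖t‖ ≤ α₄ / 4 → B₂' * ‖Dp (lamOf s) - Dp (lamOf t)‖ ≤ lE₂ * ‖s - t‖ :=
    fun s t hps hpt hs ht => by
    rw [lE₂_def, mul_assoc]; exact mul_le_mul_of_nonneg_left (hDpL s t hps hpt hs ht) hB₂
  have hsubH : ∀ s t : lamSubK η U₀ L k Eb, (-I) • H' (Dp (lamOf s)) - (-I) • H' (Dp (lamOf t)) = (-I) • H' (Dp (lamOf s) - Dp (lamOf t)) :=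
    fun s t => by rw [map_sub, smul_sub]
  -- the eight binders of JOIN-B for `H_c λ := −i·H′D′(u₁⁻¹, −iλ)`
  have hc0 : ∀ s : lamSubK η U₀ L k Eb, (∀ (z : Site d) (i : Fin d), lamOf s (z + P • e i) = lamOf s z) → ‖s‖ ≤ α₄ / 4 →
      ∀ x, ‖((-I) • H' (Dp (lamOf s))) x‖ ≤ hE := fun s hp hs x => by
    rw [Pi.smul_apply, norm_negI_smul]; exact (hH0 _ x).trans (hbdX s hp hs)
  have hc1 : ∀ s : lamSubK η U₀ L k Eb, (∀ (z : Site d) (i : Fin d), lamOf s (z + P • e i) = lamOf s z) → ‖s‖ ≤ α₄ / 4 → ∀ j, j ≤ k → ∀ p ∈ Eb j,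
      wt L η j * ‖covDerivFwd η U₀ p.2 ((-I) • H' (Dp (lamOf s))) p.1‖ ≤ hE := fun s hp hs j hj p hpj => by
    rw [covDerivFwd_smul, norm_negI_smul]; exact (hH1 j hj _ p hpj).trans (hbdX s hp hs)
  have hc2 : ∀ s : lamSubK η U₀ L k Eb, (∀ (z : Site d) (i : Fin d), lamOf s (z + P • e i) = lamOf s z) → ‖s‖ ≤ α₄ / 4 →
      Bd2 L η k Ω (covLap η U₀ ((-I) • H' (Dp (lamOf s)))) hE₂ :=
    fun s hp hs j hj x hx => by
    rw [covLap_smul, norm_negI_smul]; exact (hH2 _ j hj x hx).trans (hbdX₂ s hp hs)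
  have hcL0 : ∀ s t : lamSubK η U₀ L k Eb, (∀ (z : Site d) (i : Fin d), lamOf s (z + P • e i) = lamOf s z) → (∀ (z : Site d) (i : Fin d), lamOf t (z + P • e i) = lamOf t z) →
      ‖s‖ ≤ α₄ / 4 → ‖t‖ ≤ α₄ / 4 → ∀ x,
      ‖((-I) • H' (Dp (lamOf s))) x - ((-I) • H' (Dp (lamOf t))) x‖ ≤ lE * ‖s - t‖ := fun s t hps hpt hs ht x => by
    rw [← Pi.sub_apply, hsubH, Pi.smul_apply, norm_negI_smul]; exact (hH0 _ x).trans (hbdL s t hps hpt hs ht)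
  have hcL1 : ∀ s t : lamSubK η U₀ L k Eb, (∀ (z : Site d) (i : Fin d), lamOf s (z + P • e i) = lamOf s z) → (∀ (z : Site d) (i : Fin d), lamOf t (z + P • e i) = lamOf t z) →
      ‖s‖ ≤ α₄ / 4 → ‖t‖ ≤ α₄ / 4 → ∀ j, j ≤ k → ∀ p ∈ Eb j,
      wt L η j * ‖covDerivFwd η U₀ p.2 ((-I) • H' (Dp (lamOf s)) - (-I) • H' (Dp (lamOf t))) p.1‖ ≤ lE * ‖s - t‖ :=
    fun s t hps hpt hs ht j hj p hpj => by
    rw [hsubH, covDerivFwd_smul, norm_negI_smul]; exact (hH1 j hj _ p hpj).trans (hbdL s t hps hpt hs ht)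
  have hcL2 : ∀ s t : lamSubK η U₀ L k Eb, (∀ (z : Site d) (i : Fin d), lamOf s (z + P • e i) = lamOf s z) → (∀ (z : Site d) (i : Fin d), lamOf t (z + P • e i) = lamOf t z) →
      ‖s‖ ≤ α₄ / 4 → ‖t‖ ≤ α₄ / 4 →
      Bd2 L η k Ω (covLap η U₀ ((-I) • H' (Dp (lamOf s))) - covLap η U₀ ((-I) • H' (Dp (lamOf t)))) (lE₂ * ‖s - t‖) :=
    fun s t hps hpt hs ht j hj x hx => by
    rw [Pi.sub_apply, ← covLap_sub, hsubH, covLap_smul, norm_negI_smul]; exact (hH2 _ j hj x hx).trans (hbdL₂ s t hps hpt hs ht)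
  have hcsa : ∀ s : lamSubK η U₀ L k Eb, (∀ (z : Site d) (i : Fin d), lamOf s (z + P • e i) = lamOf s z) → ‖s‖ ≤ α₄ / 4 → (∀ x, IsSelfAdjoint (lamOf s x)) →
      ∀ x, IsSelfAdjoint (((-I) • H' (Dp (lamOf s))) x) := fun s hp hs hsa x => by
    rw [Pi.smul_apply]
    refine isSelfAdjoint_negI_smul_of_skew ?_
    have hX : ∀ p, Dp (lamOf s) p = -star (Dp (lamOf s) p) := fun p => by rw [hDpR s hp hs hsa p, neg_neg]
    have h2 := congrArg star (hHequiv (Dp (lamOf s)) (Dp (lamOf s)) hX x)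
    rw [star_neg, star_star] at h2
    exact h2
  have hcsupp : ∀ s : lamSubK η U₀ L k Eb, (∀ (z : Site d) (i : Fin d), lamOf s (z + P • e i) = lamOf s z) → ‖s‖ ≤ α₄ / 4 →
      ∀ x, x ∉ Ω 0 → ((-I) • H' (Dp (lamOf s))) x = 0 := fun s _ _ x hx => by
    rw [Pi.smul_apply, hHsupp _ x hx, smul_zero]
  -- on the torus: `H_cλ_s = −i·H′D′(λ_s)` is periodic (D′(λ_s) is level-periodic, `H′` preserves periodicity)
  have hcper : ∀ s : lamSubK η U₀ L k Eb, (∀ (z : Site d) (i : Fin d), lamOf s (z + P • e i) = lamOf s z) → ‖s‖ ≤ α₄ / 4 →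
      ∀ (z : Site d) (i : Fin d), ((-I) • H' (Dp (lamOf s))) (z + P • e i) = ((-I) • H' (Dp (lamOf s))) z := fun s hp hs z i => by
    rw [Pi.smul_apply, Pi.smul_apply, hHper _ (hDp s hp hs).1 z i]
  -- «Q′(u₁⁻¹, e^{−iλ′}) = 0 on 𝔅_k» from (1.114), in the shape of the local route
  have h179E : ∀ s : lamSubK η U₀ L k Eb, (∀ (z : Site d) (i : Fin d), lamOf s (z + P • e i) = lamOf s z) → ‖s‖ ≤ α₄ / 4 → q (lamOf s) = 0 →
      Cond179 L k Λs U₀ (fun x => expUnit (((-I) • (lamOf s + (-I) • H' (Dp (lamOf s)))) x)) u₁⁻¹ := fun s hp hs hq0 =>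
    cond179_of_eq114' H' q hq s (hDp s hp hs).2.2.2.2.2 hq0
  -- r04's Prop-10 windows at 8α₄ from the Sect. E windows at 2α₄
  have hC6 : (0 : ℝ) ≤ C6 d := by
    have : (2 : ℝ) ≤ C6 d := by unfold C6; linarith only [one_le_C5 (d := d)]
    linarith only [this]
  have hw₁ : 10 * C6 d * (4 * (2 * α₄)) ≤ 1 := by nlinarith only [hs₁, hC6, hα₄.le]
  have hw₂ : 3000 * ((d : ℝ) + 1) * L * (4 * (2 * α₄)) ≤ 1 := by
    have e : 3000 * ((d : ℝ) + 1) * L * (4 * (2 * α₄)) = 12000 * ((d : ℝ) + 1) * L * (2 * α₄) := by ring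
    rw [e]; exact hs₂
  exact hFP_kLevel_of179_local_RD_src_per hL hη hd hU₀ P hEbΩ hEbT g Δ q qs Aw c g_rightΩ c_range hU₀per
    hAper hGper hqcq_per hΔ hqs (fun lam => (-I) • H' (Dp lam)) hα hα3 hα4 hcB hαP hαP3 hαP2 hBu h33 h69 hP hAx h129 hsmall hc₃ hsc hα₃' hw₁
    hw₂ hs₃ hs₄ hs₅ hs₆ hprod hα₄ hBG hBR hhE hhE₂ hlE hlE hlE₂ hcA hcA' hcDA ha₁' hb₁' hb₁ hθ hh₀' hh₀' hG hGsupp hGreal hRbd hRreal hc0 hc1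
    hc2 hcL0 hcL1 hcL2 hcsa hcsupp hcper hDA hDAsa hA hAsa hmf hf hfsa hfper h103 h106 h179E

/-- ★★ **JOIN-C WITH A SOURCE, LOCAL ROUTE, [3]'S REMAINDER COVARIANCE DISCHARGED, ON THE TORUS** — the theorem the periodic sourced ∃λ-storeys
(`B8SockHFPRDSrcPer`) instantiate: `hFP_kLevel_of_sectE_local_RD_src_per` with `hCequiv` PROVED by `B8SectERemainderCovariance.Cnl_negStar_inv_of_axial`
from the Theorem-4 datum, windows at `hprod8` — t2s-1's `B8SectETraceFreePer.hFP_kLevel_of_sectE_local'_RD_traceFree_per` minus the trace functional,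
plus dag-n05-d's source delta.
[cite: Balaban1985RegularSpaces, Prop. 5 (1.107)–(1.109) p.94, (1.92) p.91, (1.95)–(1.106) pp.92–94, (1.113)–(1.121) pp.95–97, Thm 8 (1.146) p.101, (1.29) p.81, §3 p.98; Balaban1985Averaging, (78)–(80) p.30, (178) p.45, Prop. 10 (203)–(208) p.50] -/
theorem hFP_kLevel_of_sectE_local'_RD_src_per (hL : 2 ≤ L) (hη : 0 < η) (hU₀ : ∀ x κ, U₀ x κ ∈ unitaryUnits 𝔸) (P : ℤ)
    (hEbΩ : ∀ j, j ≤ k → ∀ x ∈ Ω j, ∀ μ : Fin d, (x, μ) ∈ Eb j ∧ (x - e μ, μ) ∈ Eb j)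
    (hEbT : ∀ j, j ≤ k → ∀ y ∈ Λs j, ∀ (x : Site d) (κ : Fin d), InBox (tlo L y j) (thi L y j) x →
      InBox (tlo L y j) (thi L y j) (x + e κ) → (x, κ) ∈ Eb j)
    -- letters of [4]
    (g Δ : (Site d → 𝔸) →ₗ[ℂ] (Site d → 𝔸)) (q : (Site d → 𝔸) →ₗ[ℂ] (ℕ → Site d → 𝔸)) (qs : (ℕ → Site d → 𝔸) →ₗ[ℂ] (Site d → 𝔸))
    (Aw c : (ℕ → Site d → 𝔸) →ₗ[ℂ] (ℕ → Site d → 𝔸))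
    (g_rightΩ : ∀ x, (∀ (z : Site d) (i : Fin d), x (z + P • e i) = x z) → ∀ y ∈ Ω 0, (Δ (g x) + qs (Aw (q (g x)))) y = x y)
    (c_range : ∀ f, (∀ (z : Site d) (i : Fin d), f (z + P • e i) = f z) → q (g (g (qs (c (q f))))) = q f)
    -- the torus: period `P` (every `Lʲ ∣ P`), shift-invariant `Λ_j`, periodic `U₀`, `A`, `u₁`; periodicity-preserving `G′`, `Q′ᵀCQ′`, `H′`
    (hdiv : ∀ j, j ≤ k → ((L : ℤ) ^ j ∣ P))
    (hΛ : ∀ j, j ≤ k → ∀ (y : Site d) (i : Fin d), y + (P / (L : ℤ) ^ j) • e i ∈ Λs j ↔ y ∈ Λs j)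
    (hU₀per : ∀ (z : Site d) (i : Fin d), U₀ (z + P • e i) = U₀ z) (hAper : ∀ (z : Site d) (i : Fin d), A (z + P • e i) = A z)
    (hu₁per : ∀ (z : Site d) (i : Fin d), u₁ (z + P • e i) = u₁ z)
    (hGper : ∀ (f : Site d → 𝔸) (z : Site d) (i : Fin d), g f (z + P • e i) = g f z)
    (hqcq_per : ∀ f : Site d → 𝔸, (∀ (z : Site d) (i : Fin d), f (z + P • e i) = f z) →
      ∀ (z : Site d) (i : Fin d), qs (c (q f)) (z + P • e i) = qs (c (q f)) z)
    (hΔ : ∀ (f : Site d → 𝔸), ∀ x ∈ Ω 0, Δ f x = covLap η U₀ ((Ω 0).indicator f) x)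
    (hqs : ∀ (μ : ℕ → Site d → 𝔸), ∀ x ∈ Ω 0, qs μ x = QT L k Λs U₀ μ x)
    (hq : ∀ (f : Site d → 𝔸) (j : ℕ), j ≤ k → ∀ y ∈ Λs j, q f j y = QprimeIter (zdBlocking d L) (bgT L U₀) j f y)
    -- the letter H′ of [4] ((1.92)) and the Sect. E / local-inversion / covariance regime (tower-local, everything AT u₁)
    (H' : XSpace d k 𝔸 →ₗ[ℂ] (Site d → 𝔸)) {B : Site d → Fin d → 𝔸} {α₀ αP α₄ cB B₀' B₂' : ℝ}
    (hα : 0 < α₀) (hα3 : C0 d * α₀ ≤ 1 / 3) (hα4 : 4 * α₀ ≤ c2' d L) (hcB : 0 ≤ cB) (hα₄ : 0 < α₄) (hB : 0 < B₀') (hB₂ : 0 ≤ B₂')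
    (h33 : ∀ j, j ≤ k → ∀ y ∈ Λs j, pdevOn (tlo L y j) (thi L y j) U₀ < α₀ * (((L : ℝ) ^ j)⁻¹) ^ 2)
    (h69 : ∀ j, j ≤ k → ∀ y ∈ Λs j, ∀ (x : Site d) (κ : Fin d), InBox (tlo L y j) (thi L y j) x →
      InBox (tlo L y j) (thi L y j) (x + e κ) → ‖B x κ‖ ≤ cB * ((L : ℝ) ^ j)⁻¹)
    (hd : 1 ≤ d) (hαP : 0 < αP) (hαP3 : C0 d * αP ≤ 1 / 3) (hαP2 : 2 * αP ≤ c2' d L)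
    (hBu : ∀ (x : Site d) (κ : Fin d), expCfg B x κ ∈ unitaryUnits 𝔸)
    (hP : ∀ j, j ≤ k → ∀ y ∈ Λs j, pdevOn (tlo L y j) (thi L y j) (expCfg B * U₀) < αP * (((L : ℝ) ^ j)⁻¹) ^ 2)
    (hAx : InAx L k Λs U₀ (mgauge U₀ u₁ (expCfg B) * U₀)) (h129 : Restr129 L k Λs U₀ u₁)
    (hH0 : ∀ (X : XSpace d k 𝔸) (x : Site d), ‖H' X x‖ ≤ B₀' * ‖X‖)
    (hH1 : ∀ j, j ≤ k → ∀ (X : XSpace d k 𝔸), ∀ p ∈ Eb j, wt L η j * ‖covDerivFwd η U₀ p.2 (H' X) p.1‖ ≤ B₀' * ‖X‖)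
    (hH2 : ∀ X : XSpace d k 𝔸, Bd2 L η k Ω (covLap η U₀ (H' X)) (B₂' * ‖X‖))
    (hHsupp : ∀ (X : XSpace d k 𝔸) (x : Site d), x ∉ Ω 0 → H' X x = 0)
    (hHequiv : ∀ X Y : XSpace d k 𝔸, (∀ p, Y p = -star (X p)) → ∀ x, H' Y x = -star (H' X x))
    (hHper : ∀ X : XSpace d k 𝔸, (∀ (p : Fin (k + 1) × Site d) (i : Fin d), X (p.1, p.2 + (P / (L : ℤ) ^ (p.1 : ℕ)) • e i) = X p) →
      ∀ (z : Site d) (i : Fin d), H' X (z + P • e i) = H' X z)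
    (hQH : ∀ (Y : XSpace d k 𝔸), (∀ (p : Fin (k + 1) × Site d) (i : Fin d), Y (p.1, p.2 + (P / (L : ℤ) ^ (p.1 : ℕ)) • e i) = Y p) →
      ∀ (j : ℕ) (hj : j ≤ k) (y : Site d), y ∈ Λs j →
      QprimeIter (zdBlocking d L) (bgT L U₀) j (H' Y) y = Y (⟨j, Nat.lt_succ_of_le hj⟩, y))
    (hsmall : Real.exp (4 * (800 * ((d : ℝ) + 1) ^ 2 * ((d : ℝ) + 4)) * α₀) * (1 + 8 * (131072 * ((d : ℝ) + 1) ^ 2) * cB) ≤ 2)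
    (hc₃ : 2 * cB ≤ c3 d L) (hsc : 2048 * (d : ℝ) * cB ≤ 1) (hα₃' : 40 * d * cB ≤ 1 / 200)
    (hs₁ : 200 * C6 d * (2 * α₄) ≤ 1) (hs₂ : 12000 * ((d : ℝ) + 1) * L * (2 * α₄) ≤ 1)
    (hs₃ : C4G d L * (α₀ + 40 * d * cB + 4 * (2 * α₄)) ≤ 1)
    (hs₄ : 1024 * ((d : ℝ) + 1) * ((d : ℝ) + 4) * L ^ 2 * α₀ ≤ 1) (hs₅ : 32 * ((d : ℝ) + 1) ^ 2 * C6 d * L ^ 2 * α₀ ≤ 1)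
    (hs₆ : 16 * d * C5' d * C6 d * (L : ℝ) ^ 2 * α₀ ≤ 1) (hs₇ : 8 * d * C6 d * L * α₀ ≤ 1)
    (hsm : 40 * d * cB + α₄ ≤ 1 / (4 * B₀' * (2 * C2p d))) (hprod8 : 2 * C6 d * (40 * d * cB + 4 * α₄) ≤ 1 / 8)
    -- the Sect. E sizes of H_c (named, so that the windows below read)
    {hE hE₂ lE lE₂ : ℝ} (hE_def : hE = B₀' * (C2p d * (40 * d * cB + α₄) * α₄)) (hE₂_def : hE₂ = B₂' * (C2p d * (40 * d * cB + α₄) * α₄))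
    (lE_def : lE = B₀' * (4 * C2p d * (40 * d * cB + 2 * α₄))) (lE₂_def : lE₂ = B₂' * (4 * C2p d * (40 * d * cB + 2 * α₄)))
    -- JOIN-B's letters G′, R, the datum, and its windows at these sizes
    {BG BR cA cDA : ℝ} (hBG : 0 ≤ BG) (hBR : 0 ≤ BR) (hcA : 0 ≤ cA) (hcA' : cA ≤ 1 / 13) (hcDA : 0 ≤ cDA)
    (ha₁' : α₄ / 4 + hE ≤ 1 / 24) (hb₁' : α₄ / 4 + hE ≤ 1 / 140) (hθ : 10 * (α₄ / 4 + hE) * BR ≤ 1 / 2)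
    (hG : ∀ (f : Site d → 𝔸) (m : ℝ), 0 ≤ m → Bd2 L η k Ω f m →
      (∀ x, ‖g f x‖ ≤ BG * m) ∧ ∀ j, j ≤ k → ∀ p ∈ Eb j, wt L η j * ‖covDerivFwd η U₀ p.2 (g f) p.1‖ ≤ BG * m)
    (hGsupp : ∀ (f : Site d → 𝔸) (x : Site d), x ∉ Ω 0 → g f x = 0)
    (hGreal : ∀ f : Site d → 𝔸, (∀ j, j ≤ k → ∀ x ∈ Ω j, IsSelfAdjoint (f x)) → ∀ x, IsSelfAdjoint (g f x))
    (hRbd : ∀ (f : Site d → 𝔸) (m : ℝ), 0 ≤ m → Bd2 L η k Ω f m → Bd2 L η k Ω (f - g (qs (c (q (g f))))) (BR * m))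
    (hRreal : ∀ f : Site d → 𝔸, (∀ j, j ≤ k → ∀ x ∈ Ω j, IsSelfAdjoint (f x)) →
      ∀ j, j ≤ k → ∀ x ∈ Ω j, IsSelfAdjoint ((f - g (qs (c (q (g f))))) x))
    (hDA : Bd2 L η k Ω (fun y => covDivB η U₀ A y) cDA) (hDAsa : ∀ j, j ≤ k → ∀ x ∈ Ω j, IsSelfAdjoint (covDivB η U₀ A x))
    (hA : ∀ j, j ≤ k → ∀ x ∈ Ω j, ∀ μ : Fin d,
      wt L η j * ‖A x μ‖ ≤ cA ∧ wt L η j * ‖conjR (U₀ (x - e μ) μ)⁻¹ (A (x - e μ) μ)‖ ≤ cA)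
    (hAsa : ∀ x μ, IsSelfAdjoint (A x μ))
    -- THE SOURCE of Theorem 8's (1.146): a fixed PERIODIC function with finite `|f|₍₋₂₎` on the `Ω_j`, Hermitian there («f from the space R(U₀)»)
    {f : Site d → 𝔸} {mf : ℝ} (hmf : 0 ≤ mf) (hf : Bd2 L η k Ω f mf) (hfsa : ∀ j, j ≤ k → ∀ x ∈ Ω j, IsSelfAdjoint (f x))
    (hfper : ∀ (z : Site d) (i : Fin d), f (z + P • e i) = f z)
    (h103 : BG * Mc d BR (α₄ / 4 + hE) cA (hE₂ + mf / 2) cDA ≤ α₄ / 4)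
    (h106 : BG * Kc d BR (α₄ / 4 + hE) cA (hE₂ + mf / 2) cDA lE₂ (1 + lE) (1 + lE) ≤ 1 / 2) :
    ∃ lam : Site d → 𝔸, (∀ (z : Site d) (i : Fin d), lam (z + P • e i) = lam z) ∧
      (∀ x, IsSelfAdjoint (lam x)) ∧ (∀ x, x ∉ Ω 0 → lam x = 0) ∧
      (∀ j, j ≤ k → ∀ p ∈ Eb j, ‖lam p.1‖ ≤ α₄ ∧ wt L η j * ‖covDerivFwd η U₀ p.2 lam p.1‖ ≤ α₄) ∧
      (∃ μ : ℕ → Site d → 𝔸, ∀ x ∈ Ω 0,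
        covLap η U₀ ((Ω 0).indicator fun y => covDivB η U₀ A y + covLap η U₀ lam y +
          ((conjR (gaugeExp lam y)⁻¹ (covDivB η U₀ A y) - covDivB η U₀ A y) +
            (gAd (covLap η U₀ lam y) (lam y) - covLap η U₀ lam y) + ∑ μ, frakF3 η U₀ lam A y μ) - f y) x = QT L k Λs U₀ μ x) ∧
      Restr129 L k Λs U₀ (u₁ * gaugeExp lam) := by
  have hC6 : (0 : ℝ) ≤ C6 d := by
    have : (2 : ℝ) ≤ C6 d := by unfold C6; linarith only [one_le_C5 (d := d)]
    linarith only [this]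
  have hα₃ : (0 : ℝ) ≤ 40 * d * cB := by positivity
  have hC4G : 0 ≤ C4G d L := by
    have h7 : (0 : ℝ) ≤ B7Prop10General.C7 d := by
      unfold B7Prop10General.C7 C6; linarith only [one_le_C5 (d := d), C5'_nonneg (d := d)]
    have h4' := C4'_nonneg (d := d)
    unfold C4G; positivity
  -- the local route's product window and (D)'s windows at 4α₄ from the Sect. E windows at 2α₄ and `hprod8`
  have hprod : 2 * C6 d * (40 * d * cB + 4 * (2 * α₄)) < 1 / 2 := by nlinarith only [hprod8, hC6, hα₃, hα₄.le]
  have h204w : C6 d * (4 * α₄) ≤ 1 / 8 := by nlinarith only [hprod8, hC6, hα₃, hα₄.le]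
  have hd₁ : 10 * C6 d * (4 * α₄) ≤ 1 := by nlinarith only [hs₁, hC6, hα₄.le]
  have hd₂ : 3000 * ((d : ℝ) + 1) * L * (4 * α₄) ≤ 1 := by
    have e : 3000 * ((d : ℝ) + 1) * L * (4 * α₄) = 12000 * ((d : ℝ) + 1) * L * (2 * α₄) / 2 := by ring
    rw [e]; linarith only [hs₂, show (0:ℝ) ≤ 12000 * ((d : ℝ) + 1) * L * (2 * α₄) by positivity]
  have hd₃ : C4G d L * (α₀ + 40 * d * cB + 4 * α₄) ≤ 1 :=
    (mul_le_mul_of_nonneg_left (by linarith only [hα₄]) hC4G).trans hs₃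
  have hCequiv := Cnl_negStar_inv_of_axial Λs hd hL (le_trans (by norm_num) hL) hU₀ hα hα3 hα4 hcB hα₄ hαP hαP3 hαP2 hBu h33 h69 hP hAx h129
    hsmall hc₃ hsc (by linarith only [hα₃']) hd₁ hd₂ hd₃ hs₄ hs₅ hs₆ hprod8 h204w
  exact hFP_kLevel_of_sectE_local_RD_src_per hL hη hU₀ P hEbΩ hEbT g Δ q qs Aw c g_rightΩ c_range hdiv hΛ hU₀per hAper hu₁per
    hGper hqcq_per hΔ hqs hq H' hα hα3 hα4 hcB hα₄ hB hB₂ h33 h69 hd hαP hαP3 hαP2 hBu hP hAx h129 hH0 hH1 hH2 hHsupp hHequiv hHper hQH hCequiv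
    hsmall hc₃ hsc hα₃' hs₁ hs₂ hs₃ hs₄ hs₅ hs₆ hs₇ hsm hprod hE_def hE₂_def lE_def lE₂_def hBG hBR hcA hcA' hcDA ha₁' hb₁' hθ hG hGsupp hGreal
    hRbd hRreal hDA hDAsa hA hAsa hmf hf hfsa hfper h103 h106

end JoinLocal

#print axioms hFP_kLevel_of179_local_RD_src_per
#print axioms hFP_kLevel_of_sectE_local_RD_src_per
#print axioms hFP_kLevel_of_sectE_local'_RD_src_per

end Literature.MathematicalPhysics.QuantumFieldTheory.Balaban1983to89.B8Prop5JoinSectELocalRDSrcPer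

end
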